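import Literature.NumberTheory.GelbartRogawski1991.Sec1Defs
import Literature.NumberTheory.GelbartRogawski1991.Sec2
import HarnessLib

/-!
# Gelbart–Rogawski 1991, Introduction p. 448 ¶3: «stable» discrete representations of `U(3)` and the necessary
# condition «`Hom_{R_v}(π_v, τ_v) ≠ 0` for all `v`» for the non-vanishing of a Fourier–Jacobi coefficient `φ_τ`

S. Gelbart, J. Rogawski, *L-functions and Fourier–Jacobi coefficients for the unitary group `U(3)`*, Invent. Math. **105**
(1991) 445–472 [GelbartRogawski1991], Introduction p. 448 ¶3 (with the sentence of the proof of Theorem 2.4.1, p. 452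
L37–38, that proves the necessary condition in passing).  Read on the GDZ page images `img_p448.jpg`, `img_p452.jpg`
(PPN356556735_0105; cell copy `pub-hodgecm-cf-rogawski-g6/lit/GR91-invent105/`).  Carpet-typing squad TG (cell
hodgecm-mathlib, seat TG-t05; planner ruling 03:10Z∕03:11Z «Intro residue», coverage-ledger row I-33 of TG-t07); namespace
`Literature.NumberTheory.GelbartRogawski1991.Intro`.

THE PRINT (p. 448 ¶3): «A discrete representation `π` of `G` which belongs neither to an endoscopic `L`-packet nor to an
`A`-packet is called stable.  It would be interesting to determine when the Fourier–Jacobi coefficients `φ_τ` are non-zero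
for a stable `π`.  A necessary condition is that `Hom_{R_v}(π_v, τ_v) ≠ 0` for all `v`.  Is this sufficient?  We note that
the coefficients `φ_τ` for holomorphic Eisenstein series were calculated explicitly by Hickey ([Hi]) and found to equal a
ratio of special values of Hecke `L`-series.»  (p. 452 L37–38, proof of Theorem 2.4.1, for a discrete `π` and `τ ∈ R^∧`
with `φ_τ ≢ 0`, `τ = ⊗τ_v`: «Define `L : V_π → V_τ` by `L(φ) = φ_τ`. Since `L` is non-zero, it follows that
`Hom_{R_v}(π_v, τ_v) ≠ {0}` for all `v`.»)

DISCIPLINE (that of the squad's carpets): two declarations over the ★ dictionaries and data already in the tree, NOTHING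
asserted, no theorem, no `sorry`, no axiom, no instance, no notation —
* `IsStable D π` — the DEFINITION «stable» over the squad's ★ global datum `D : Sec1Defs.EndoscopicLData X HeckeE HeckeF`
  (`X : GR91Spectrum`; endoscopic `L`-packets `Π(ϱ)`, `ϱ = ϱ₂ × ϱ₁`, `dim ϱ ≠ 1` = ★ `D.packetL` under the guards ★
  `Sec1.lean` uses; `A`-packets `Π(ϱ)`, `dim ϱ = 1` = ★ `X.packetA`; «discrete» = ★ `X.IsDiscrete`);
* `fjNonzero_hasModel_all J L locR` — the NECESSARY CONDITION as a predicate AT ONE PLACE `v`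
  over the ★ Fourier–Jacobi datum `J : Sec2Defs.GR91RData X GA` (`Λ(π)` = ★ `J.Lambda π` = «`{τ ∈ R^∧ : φ_τ ≠ 0` for some
  `φ ∈ V_π}`», p. 452 L1–2), the ★ local Heisenberg carrier `H : GelbartRogawski1990.CitedRows.HeisData Y`
  (`H.HasModel π_v τ_v` = «`Hom_{R_v}(π_v, τ_v) ≠ {0}`») and ★ `L : Sec2.LocalFJData X Y H` (`L.loc π = π_v`), plus ONE
  socket taken as a PARAMETER: `locR τ = τ_v`, the local component at `v` of `τ ∈ R^∧` («we identify `τ` with `⊗τ_v`»,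
  p. 452 L34) — nobody in the tree posits it yet (★ `CitedRows.HeisData.tauOf` is the local `τ(γ_v,ψ_v,χ_v)`, ★
  `Sec3ThetaDefs` carries the global `τ(γ,ψ,χ)`); «for all `v`» = the consumer instantiates the predicate at every place.
The QUESTION «Is this sufficient?» is an open question of the paper and is recorded here only (not a statement); [Hi] =
T. Hickey, thesis (Chicago 1986), external, not typed.

NOT here: everything else of the Introduction — see ★ `GR91Spectrum` (the Weil representations, the two main results, the
`H¹` sentence), ★ `Sec1.lean` (the packet sentences of p. 446), and TG-t07's coverage ledger `COVERAGE-GR91.md`.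

## References
* [GelbartRogawski1991] Invent. Math. 105 (1991): Introduction p. 448 ¶3 (L19–24); §2.3 p. 452 L1–2 (`Λ(π)`); proof of
  Thm. 2.4.1 p. 452 L34–38.
* [Rogawski1990] Ann. of Math. Stud. 123 (= [R]): §13.3 pp. 201–202, `Π_e(G)`, `Π_a(G)`, `Π_s(G)` («stable») — the
  book's trichotomy is ★ `Literature.NumberTheory.Rogawski1990.GlobalPacketData.IsEndoscopic ∕ IsAPacket ∕ IsStable`
  (file `GlobalPackets.lean`), the [R]-side PARALLEL of `IsStable` below (different datum; cited, not restated).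
-/

noncomputable section

namespace Literature.NumberTheory.GelbartRogawski1991.Intro

open Sec1Defs (EndoscopicLData)
open Sec2Defs (GR91RData)
open Sec2 (LocalFJData)

universe u

variable {X : GR91Spectrum.{u}}

/-- **DEFINITION — «stable»** (Introduction p. 448 ¶3): «A discrete representation `π` of `G` which belongs neither to
an endoscopic `L`-packet nor to an `A`-packet is called stable.»  Endoscopic `L`-packets = the `Π(ϱ)` of §1.4 for
discrete `ϱ = ϱ₂ × ϱ₁` on `H = U(2) × U(1)` with `dim ϱ ≠ 1` (★ `D.packetL ϱ₂ ϱ₁`, under the guards of ★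
`EndoscopicLData.lFactorisation`; p. 447 foot «such `L`-packets are called endoscopic»); `A`-packets = the `Π(ϱ)` with
`dim ϱ = 1`, `ϱ = (η, η′)` (★ `X.packetA η η′`).  [R]-side parallel: ★ `Rogawski1990.GlobalPacketData.IsStable`.
[cite: GelbartRogawski1991, Introduction p. 448 L19–20] -/
def IsStable {HeckeE HeckeF : Type u} [CommGroup HeckeE] [CommGroup HeckeF] (D : EndoscopicLData X HeckeE HeckeF)
    (π : X.Rep) : Prop :=
  X.IsDiscrete π ∧
    (∀ (ϱ₂ : D.PacketU2) (ϱ₁ : X.Char1), D.IsDiscreteU2 ϱ₂ → ¬ D.IsOneDimU2 ϱ₂ → π ∉ D.packetL ϱ₂ ϱ₁) ∧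
      ∀ η η' : X.Char1, π ∉ X.packetA η η'

/-- **P — the necessary condition for `φ_τ ≢ 0`, at the place `v`** (Introduction p. 448 ¶3 «A necessary condition is
that `Hom_{R_v}(π_v, τ_v) ≠ 0` for all `v`»; proved in passing on p. 452 L37–38: «Define `L : V_π → V_τ` by `L(φ) = φ_τ`.
Since `L` is non-zero, it follows that `Hom_{R_v}(π_v, τ_v) ≠ {0}` for all `v`»): for a discrete `π` and `τ ∈ Λ(π)`
(★ `J.Lambda π` — «`φ_τ ≠ 0` for some `φ ∈ V_π`»), `π_v` (★ `L.loc π`) has a Heisenberg model in `τ_v` (★ `H.HasModel`),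
where `locR τ = τ_v` is the local component of `τ = ⊗τ_v` at `v` (a PARAMETER socket, p. 452 L34).  Printed for the
question about STABLE `π` but valid — and proved in print — for every discrete `π`; typed so.  The sequel «Is this
sufficient?» is the paper's open question, not a statement. [cite: GelbartRogawski1991, Introduction p. 448 L21–22; proof of Thm. 2.4.1 p. 452 L37–38] -/
def fjNonzero_hasModel_all {GA : Type u} [Group GA] (J : GR91RData X GA) {Y : GR91LocalPacket.{u}}
    {H : GelbartRogawski1990.CitedRows.HeisData Y} (L : LocalFJData X Y H)
    (locR : Submodule ℂ (J.R → ℂ) → H.HeisRep) : Prop :=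
  ∀ π : X.Rep, X.IsDiscrete π → ∀ τ ∈ J.Lambda π, H.HasModel (L.loc π) (locR τ)

end Literature.NumberTheory.GelbartRogawski1991.Intro

end
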